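import Literature.Topology.FourManifolds.TautFoliationsCollarDisc
import HarnessLib

/-!
# The angular parametrisation of the square rings about the centre

Sibling of `TautFoliationsSquarePolar.lean` / `TautFoliationsCollarDisc.lean`. The ring
`sphere c₀ R` of the sup metric (a square) is parametrised by the angle: `θ ↦` the point of the
ring on the ray of angle `2πθ`, `ringParam c₀ R θ = c₀ + (R / ‖u θ‖) • u θ` with
`u θ = (cos 2πθ, sin 2πθ)`. It is continuous, at distance `R` from `c₀`, starts and ends at
`c₀ + (R, 0)`, and **its angle parameter is `θ`** (`angleParam_ringParam`, `θ ∈ [0, 1)`), so that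
the collar disc read along it is exactly the horizontal loop of the fence at the level of `R`
(`apply_ringParam`). This is the parametrisation over which the image of a contour leaf of the
coned collar is compared with the lift of the loop.

* `SquarePolar.dir`, `SquarePolar.ringParam` (**definitions**) and their lemmas (**proved**);
* `SquarePolar.angleParam_ringParam`, `SquarePolar.apply_ringParam` (**proved**).

All statements are [folklore].
-/

noncomputable section

open Set Filter Metric Topology Function Real
open scoped unitInterval

namespace Literature.Topology.FourManifolds

namespace SquarePolar

variable {c₀ : ℝ × ℝ} {R : ℝ}

/-- The unit direction of angle `2πθ`. [folklore] -/
def dir (θ : ℝ) : ℝ × ℝ := (Real.cos (2 * π * θ), Real.sin (2 * π * θ))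

/-- `dir` is continuous. [folklore] -/
theorem continuous_dir : Continuous dir :=
  (Real.continuous_cos.comp (continuous_const.mul continuous_id)).prodMk (Real.continuous_sin.comp (continuous_const.mul continuous_id))

/-- The sup norm of a direction is at least `1 / 2` (indeed `≥ 1/√2`). [folklore] -/
theorem half_le_norm_dir (θ : ℝ) : 1 / 2 ≤ ‖dir θ‖ := by
  rw [dir, Prod.norm_def, Real.norm_eq_abs, Real.norm_eq_abs]
  have h := Real.cos_sq_add_sin_sq (2 * π * θ)
  by_contra hlt
  push Not at hlt
  have h1 : |Real.cos (2 * π * θ)| < 1 / 2 := lt_of_le_of_lt (le_max_left _ _) hlt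
  have h2 : |Real.sin (2 * π * θ)| < 1 / 2 := lt_of_le_of_lt (le_max_right _ _) hlt
  have h1' := abs_lt.1 h1; have h2' := abs_lt.1 h2
  nlinarith

/-- The sup norm of a direction is positive. [folklore] -/
theorem norm_dir_pos (θ : ℝ) : 0 < ‖dir θ‖ := lt_of_lt_of_le (by norm_num) (half_le_norm_dir θ)

/-- **The angular parametrisation of the ring of radius `R`.** [folklore] -/
def ringParam (c₀ : ℝ × ℝ) (R θ : ℝ) : ℝ × ℝ := c₀ + (R / ‖dir θ‖) • dir θ

/-- The ring parametrisation is continuous. [folklore] -/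
theorem continuous_ringParam (c₀ : ℝ × ℝ) (R : ℝ) : Continuous (ringParam c₀ R) := by
  unfold ringParam
  have h : Continuous fun θ ↦ R / ‖dir θ‖ :=
    continuous_const.div (continuous_norm.comp continuous_dir) fun θ ↦ (norm_dir_pos θ).ne'
  exact continuous_const.add (h.smul continuous_dir)

/-- The ring parametrisation is at distance `R` from the centre (`R ≥ 0`). [folklore] -/
theorem dist_ringParam (hR : 0 ≤ R) (θ : ℝ) : dist (ringParam c₀ R θ) c₀ = R := by
  rw [ringParam, dist_eq_norm, add_sub_cancel_left, norm_smul, Real.norm_eq_abs, abs_of_nonneg (div_nonneg hR (norm_nonneg _)),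
    div_mul_cancel₀ _ (norm_dir_pos θ).ne']

/-- The ring parametrisation is periodic: `θ = 1` gives the starting point. [folklore] -/
theorem ringParam_one : ringParam c₀ R 1 = ringParam c₀ R 0 := by
  simp [ringParam, dir]

/-- The starting point is `c₀ + (R, 0)`. [folklore] -/
theorem ringParam_zero : ringParam c₀ R 0 = c₀ + ((R, 0) : ℝ × ℝ) := by
  have h : dir 0 = ((1, 0) : ℝ × ℝ) := by simp [dir]
  rw [ringParam, h]
  have hn : ‖((1, 0) : ℝ × ℝ)‖ = 1 := by simp [Prod.norm_def]
  rw [hn, div_one]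
  ext <;> simp

/-- The complex number of the ring point is a positive multiple of `cos + i sin`. [folklore] -/
theorem toC_ringParam (θ : ℝ) :
    toC c₀ (ringParam c₀ R θ) = ((R / ‖dir θ‖ : ℝ) : ℂ) * (Real.cos (2 * π * θ) + Real.sin (2 * π * θ) * Complex.I) := by
  rw [toC, ringParam, add_sub_cancel_left, map_smul, Complex.real_smul]
  congr 1
  apply Complex.ext <;> simp [-Complex.ofReal_cos, -Complex.ofReal_sin, dir]

/-- **The angle of the ring point of parameter `θ` is `2πθ`.** [folklore] -/
theorem ang_ringParam (hR : 0 < R) (θ : ℝ) : ang c₀ (ringParam c₀ R θ) = ((2 * π * θ : ℝ) : Real.Angle) := by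
  show (Complex.arg (toC c₀ (ringParam c₀ R θ)) : Real.Angle) = _
  rw [toC_ringParam]
  have h := Complex.arg_mul_cos_add_sin_mul_I_coe_angle (div_pos hR (norm_dir_pos θ)) ((2 * π * θ : ℝ) : Real.Angle)
  rw [Real.Angle.cos_coe, Real.Angle.sin_coe] at h
  exact_mod_cast h

/-- **The angle parameter of the ring point of parameter `θ ∈ [0, 1)` is `θ`.** [folklore] -/
theorem angleParam_ringParam (hR : 0 < R) {θ : ℝ} (hθ : θ ∈ Ico (0 : ℝ) 1) : (angleParam c₀ (ringParam c₀ R θ) : ℝ) = θ := by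
  have h2π : (2 * π * θ) ∈ Ico (0 : ℝ) (0 + 2 * π) := by
    constructor <;> nlinarith [hθ.1, hθ.2, Real.pi_pos]
  have hrep : ((AddCircle.equivIco (2 * π) 0 (ang c₀ (ringParam c₀ R θ)) : ℝ)) = 2 * π * θ := by
    rw [ang_ringParam hR]
    have h := congrArg Subtype.val (AddCircle.equivIco_coe_eq (p := 2 * π) (a := 0) h2π)
    exact h
  unfold angleParam
  rw [hrep]
  show ((loopParam (2 * π * θ) : I) : ℝ) = θ
  rw [loopParam, show 2 * π * θ / (2 * π) = θ by field_simp, projIcc_of_mem _ ⟨hθ.1, hθ.2.le⟩]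

/-- **The collar disc along the ring parametrisation is the horizontal of the fence** at the
level of `R`: for `θ ∈ [0, 1)`, and `R ≥ L/2`, `G (s θ) = Φ θ (level R)`. [folklore] -/
theorem apply_ringParam {M : Type*} {Φ : I → ℝ → M} {G : ℝ × ℝ → M} {L τ₀ τ₁ : ℝ}
    (hG : ∀ x, L / 2 ≤ dist x c₀ → G x = Φ (angleParam c₀ x) (levelOfParam τ₀ τ₁ (1 - dist x c₀ / L)))
    (hR : 0 < R) (hRL : L / 2 ≤ R) {θ : ℝ} (hθ : θ ∈ Ico (0 : ℝ) 1) :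
    G (ringParam c₀ R θ) = Φ ⟨θ, hθ.1, hθ.2.le⟩ (levelOfParam τ₀ τ₁ (1 - R / L)) := by
  rw [hG _ (by rw [dist_ringParam hR.le]; exact hRL), dist_ringParam hR.le]
  congr 1
  exact Subtype.ext (angleParam_ringParam hR hθ)

end SquarePolar

end Literature.Topology.FourManifolds
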